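import Mathlib
import HarnessLib
import Summits.ResolutionOfSingularities.ResolutionOfSingularities.Theorems.WildQuotientsWildQuotientResolutionS1aKillOrAux

/-!
# S1a — THE AUX MEASURE `jInf` (dimension of the non-killable locus) and the two-phase rule WITH CONTENT `KillOrAuxRuleJInf`

[OURS · L1 W4.5c · lead-1 g7; plan-1 ASSIGNMENT v10.6 (2), SIG `L/w45c/W45cKillOrAux.lean` 961629f7cb64dda5 (defs verbatim), STRATEGY-DESIGN
v3.1 §3] — NOT statements of the manuscript; counted 0; AI-level work, weaker than expert review. Crux stmt-ResolutionOfSingularities-17941,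
line `s1a-logminvertex` v6, stub `stub_winningStrategy`. Route-independent.

* `KillableAt M v`, `nonKillable M`, `jInf M` (plan-1ʼs definitions, verbatim): local one-shot killability, the non-killable bad points, their
  dimension;
* `jInf_le_nu1` — `jInf ≤ ν₁`;
* `KillOrAuxRuleJInf p` (plan-1, verbatim) — KILL with `jInf` non-increasing, else AUX strictly lowering `jInf`;
* **`wins_of_killOrAuxJInf`** — the two-phase reduction with the `WithBot ℕ∞`-valued measure `jInf` (lex induction on `(jInf, ν₁)` through
  ℕ-bounds), and **`wins_initial_of_killOrAuxRuleJInf`**: the residual OF RECORD (CHAIN v10.6) makes every initial model over a field win.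
-/

set_option linter.dupNamespace false

noncomputable section

open CategoryTheory Limits AlgebraicGeometry TopologicalSpace Topology
open Literature.AlgebraicGeometry.Resolution Literature.AlgebraicGeometry.RelativeSpec
open Summit.ResolutionOfSingularities.ResolutionOfSingularities.Theorems.WildQuotientResolution.S1
open Summit.ResolutionOfSingularities.ResolutionOfSingularities.Theorems.WildQuotientResolution.S1.NodeAtlas

namespace Summit.ResolutionOfSingularities.ResolutionOfSingularities.Theorems.WildQuotientResolution.S1

namespace GameFrame.GModel

variable {p : ℕ} {X' X₁ : Scheme.{0}} {q : X' ⟶ X₁} {G : Type} [Group G] {ρ : G →* Aut X'} {g₀ : G}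

/-- **Killable at `v`**: SOME Rees filtration on `M.V` has a principal-centre chart through `v` (local one-shot killability; plan-1 SIG).
[OURS · L1 W4.5c] -/
def KillableAt (M : GModel p q G ρ g₀) (v : M.V) : Prop :=
  ∃ (𝒦 : ReesFiltration M.V) (d : ℕ) (O : M.act.StableAffineOpens), 0 < d ∧ v ∈ O.1 ∧ IsPrincipalCentreChart p M.act g₀ 𝒦 d O

/-- The NON-KILLABLE locus: bad points at which no local one-shot kill exists (plan-1 SIG). [OURS · L1 W4.5c] -/
def nonKillable (M : GModel p q G ρ g₀) : Set M.V :=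
  M.badLocus ∩ {v | ¬ KillableAt M v}

/-- **`jInf M`** := the dimension of the non-killable locus — the aux measure of STRATEGY-DESIGN v3.1 §3 (plan-1 SIG). [OURS · L1 W4.5c] -/
def jInf (M : GModel p q G ρ g₀) : WithBot ℕ∞ :=
  topologicalKrullDim ↥(nonKillable M)

/-- `jInf ≤ ν₁` (the non-killable locus sits inside the bad locus). -/
theorem jInf_le_nu1 (M : GModel p q G ρ g₀) : M.jInf ≤ M.nu1 :=
  (IsEmbedding.inclusion (Set.inter_subset_left : M.nonKillable ⊆ M.badLocus)).isInducing.topologicalKrullDim_le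

end GameFrame.GModel

/-- **THE TWO-PHASE RULE with the aux measure `jInf`** (plan-1 SIG, the residual OF RECORD of CHAIN v10.6; OURS CANDIDATE, asserted nowhere):
KILL when a principal centre meeting every bad component exists with `jInf` non-increasing on its moves, else an AUX centre all of whose
moves strictly lower `jInf`. [OURS · L1 W4.5c] -/
def KillOrAuxRuleJInf (p : ℕ) : Prop :=
  ∀ ⦃X' X₁ : Scheme.{0}⦄ (q : X' ⟶ X₁) (G : Type) [Group G] [Finite G] (ρ : G →* Aut X') (g₀ : G),
    (∀ g : G, g ∈ Subgroup.zpowers g₀) →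
    ∀ M : GameFrame.GModel p q G ρ g₀, M.HasNoetherianBase → ¬ M.Terminal →
      (∃ (𝒦 : ReesFiltration M.V) (d : ℕ), IsPrincipalCentre p M.act g₀ 𝒦 d ∧
        (∀ t ∈ irreducibleComponents ↥M.badLocus, ∃ x ∈ t, (x : M.V) ∈ M.principalKillOpen 𝒦 d) ∧
        ∀ M' : GameFrame.GModel p q G ρ g₀, M.IsMoveOf M' 𝒦 d → M'.jInf ≤ M.jInf) ∨
      (∃ (𝒦 : ReesFiltration M.V) (d : ℕ), IsAuxCentre p M.act g₀ 𝒦 d (M.badLocus)ᶜ ∧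
        ∀ M' : GameFrame.GModel p q G ρ g₀, M.IsMoveOf M' 𝒦 d → M'.jInf < M.jInf)

namespace GameFrame.GModel

variable {p : ℕ} {X' X₁ : Scheme.{0}} {q : X' ⟶ X₁} {G : Type} [Group G] {ρ : G →* Aut X'} {g₀ : G}

/-- `x < 0 ⇒ x = ⊥` in `WithBot ℕ∞`. -/
theorem withBot_eq_bot_of_lt_zero {x : WithBot ℕ∞} (h : x < ((0 : ℕ) : WithBot ℕ∞)) : x = ⊥ := by
  induction x using WithBot.recBotCoe with
  | bot => rfl
  | coe y =>
    rw [← WithBot.coe_natCast, WithBot.coe_lt_coe, Nat.cast_zero] at h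
    exact absurd h (by simp)

/-- **THE TWO-PHASE REDUCTION with the measure `jInf`.** Lex induction on `(jInf, ν₁)` through ℕ-bounds (`jInf < a`, `ν₁ < n`).
[OURS · L1 W4.5c] -/
theorem wins_of_killOrAuxJInf [Finite G] (hp : p.Prime) (hG : ∀ g : G, g ∈ Subgroup.zpowers g₀) (P : GModel p q G ρ g₀ → Prop)
    (H : ∀ M : GModel p q G ρ g₀, P M → M.HasNoetherianBase → ¬ M.Terminal →
      (∃ (𝒦 : ReesFiltration M.V) (d : ℕ), IsPrincipalCentre p M.act g₀ 𝒦 d ∧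
        (∀ t ∈ irreducibleComponents ↥M.badLocus, ∃ x ∈ t, (x : M.V) ∈ M.principalKillOpen 𝒦 d) ∧
        ∀ M' : GModel p q G ρ g₀, M.IsMoveOf M' 𝒦 d → P M' ∧ M'.HasNoetherianBase ∧ M'.jInf ≤ M.jInf) ∨
      (∃ (𝒦 : ReesFiltration M.V) (d : ℕ), IsAdmissibleCentre p M.act g₀ 𝒦 d ∧
        ∀ M' : GModel p q G ρ g₀, M.IsMoveOf M' 𝒦 d → P M' ∧ M'.HasNoetherianBase ∧ (∃ n : ℕ, M'.nu1 < n) ∧ M'.jInf < M.jInf))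
    (M₀ : GModel p q G ρ g₀) (hP₀ : P M₀) (hB₀ : M₀.HasNoetherianBase) {n₀ : ℕ} (hn₀ : M₀.nu1 < n₀) :
    Wins p q G ρ g₀ M₀ := by
  suffices h : ∀ (a n : ℕ) (M : GModel p q G ρ g₀), P M → M.HasNoetherianBase → M.jInf < a → M.nu1 < n → Wins p q G ρ g₀ M from
    h n₀ n₀ M₀ hP₀ hB₀ (lt_of_le_of_lt M₀.jInf_le_nu1 hn₀) hn₀
  intro a
  induction a using Nat.strong_induction_on with
  | _ a iha =>
    intro n
    induction n with
    | zero => exact fun M _ _ _ hn => Wins.terminal M (M.terminal_of_nu1_lt_zero hn)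
    | succ n ihn =>
      intro M hPM hBM ha hn
      by_cases hT : M.Terminal
      · exact Wins.terminal M hT
      rcases H M hPM hBM hT with ⟨𝒦, d, hprin, hhit, hmoves⟩ | ⟨𝒦, d, hadm, hmoves⟩
      · -- KILL move: `ν₁` drops, `jInf` does not increase
        refine Wins.of_moves 𝒦 d (isAdmissibleCentre_of_isPrincipalCentre hprin) fun M' hmv => ?_
        obtain ⟨hPM', hBM', hj⟩ := hmoves M' hmv
        obtain ⟨π', hbl, -, hr, hcomm⟩ := hmv
        obtain ⟨R₀, _, _, s, _, hs⟩ := hBM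
        exact ihn M' hPM' hBM' (lt_of_le_of_lt hj ha)
          (nu1_principalMove_lt hp hG M M' 𝒦 d hprin hhit π' hbl hr hcomm s hs (withBot_le_of_lt_succ hn))
      · -- AUX move: `jInf` drops strictly
        refine Wins.of_moves 𝒦 d hadm fun M' hmv => ?_
        obtain ⟨hPM', hBM', ⟨m, hm⟩, hj⟩ := hmoves M' hmv
        cases a with
        | zero => exact absurd (withBot_eq_bot_of_lt_zero ha ▸ hj) not_lt_bot
        | succ a' => exact iha a' (Nat.lt_succ_self a') m M' hPM' hBM' (lt_of_lt_of_le hj (withBot_le_of_lt_succ ha)) hm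

/-- **The rule of record makes the initial model of every datum over a field win.** [OURS · L1 W4.5c] -/
theorem wins_initial_of_killOrAuxRuleJInf (hp : p.Prime) (hrule : KillOrAuxRuleJInf p) {k : Type} [Field k] (f : X₁ ⟶ Spec (.of k))
    [LocallyOfFiniteType f] [QuasiCompact f] [IsFinite q] [Finite G] (hG : ∀ g : G, g ∈ Subgroup.zpowers g₀)
    (hq : ∀ g : G, (ρ g).hom ≫ q = q) [IsIntegral X'] [IsLocallyNoetherian X'] (h₀ : NodeAtlas p (⟨ρ, hq⟩ : ActionOver q G) g₀) :
    Wins p q G ρ g₀ (GModel.initial hq h₀) := by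
  obtain ⟨n₀, hn₀⟩ := exists_nat_nu1_lt_of_datum f (GModel.initial (p := p) (g₀ := g₀) hq h₀)
  refine wins_of_killOrAuxJInf hp hG (fun _ => True) (fun M _ hB hT => ?_) (GModel.initial hq h₀) trivial
    (hasNoetherianBase_of_datum f _) hn₀
  rcases hrule q G ρ g₀ hG M hB hT with ⟨𝒦, d, hprin, hhit, hmoves⟩ | ⟨𝒦, d, haux, hmoves⟩
  · exact Or.inl ⟨𝒦, d, hprin, hhit, fun M' hmv => ⟨trivial, hasNoetherianBase_of_datum f M', hmoves M' hmv⟩⟩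
  · exact Or.inr ⟨𝒦, d, haux.1, fun M' hmv =>
      ⟨trivial, hasNoetherianBase_of_datum f M', exists_nat_nu1_lt_of_datum f M', hmoves M' hmv⟩⟩

end GameFrame.GModel

end Summit.ResolutionOfSingularities.ResolutionOfSingularities.Theorems.WildQuotientResolution.S1

end
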